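import Literature.NumberTheory.EllipticCurves.PastenHeightBounds
import Literature.NumberTheory.EllipticCurves.RationalIsogenyDegrees
import Literature.NumberTheory.EllipticCurves.IsogenyDualProofs
import Literature.NumberTheory.EllipticCurves.NeronModelProofs
import Literature.NumberTheory.EllipticCurves.ShafarevichGoodReductionBadPlacesProofs
import Literature.NumberTheory.EllipticCurves.ComplexMultiplicationLFunctionIsogenyHoldsProofs
import Literature.NumberTheory.EllipticCurves.HasseWeilAbelianBadReduction
import Literature.NumberTheory.DiophantineGeometry.ConductorRingOfIntegersProofs
import Literature.NumberTheory.DiophantineGeometry.ConductorMultiplicativeProofs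
import HarnessLib

/-!
# Pasten 2024, Lemma 6.8 (`c_p(A)/c_p(B)` has height `≤ 163` in a `ℚ`-isogeny class):
# the printed proof, reduced to its two inputs

`Proofs` file (theorems only — no definition, no named fact, no instance) of
`Literature/NumberTheory/EllipticCurves/PastenHeightBounds.lean` for its named fact
`Literature.NumberTheory.EllipticCurves.ModularForms.PastenShimura2024_lemma_6_8`
(H. Pasten, *Shimura curves and the abc conjecture*, J. Number Theory 254 (2024) =
arXiv:1705.09251, §6.4, Lemma 6.8, p. 22, READ):

> *Lemma 6.8.* Let `A` and `B` be elliptic curves which are isogenous over `ℚ` and suppose that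
> `p` is a prime of multiplicative reduction for one (hence both) of them. Then `c_p(A)/c_p(B)` is
> a rational number whose multiplicative height is at most `163`.
>
> *Proof.* Let `α : A → B` be an isogeny of minimal degree; by results of Mazur and Kenku we know
> that `n := deg(α) ≤ 163`. Let `β : B → A` be the dual isogeny, so that `βα = [n]` on `A`. Since
> `A` and `B` have multiplicative reduction at `p`, we have isomorphisms of abstract groups
> `Φ_p(A) = ℤ/c_p(A)ℤ` and `Φ_p(B) = ℤ/c_p(B)ℤ` [and `Φ_p` is functorial with `[n]_{p,*} = n·`].
> From this we get that `c_p(A)/(n, c_p(A)) = # im(n·)` divides `# im(β_{p,*})`, which divides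
> `c_p(B)`. Thus, the numerator of `c_p(A)/c_p(B)` divides `n`, and similarly for the denominator
> using `αβ` instead. □

The printed proof has exactly two non-elementary inputs, neither of which is a theorem of the tree:

* **(MK) Mazur–Kenku** — the tree's (unproved) named fact
  `Literature.NumberTheory.EllipticCurves.mazurKenku_exists_cyclic_isogeny`
  (`RationalIsogenyDegrees.lean`; Mazur 1978, Thm. 1; Kenku 1982; Silverman *AEC* IX.6 Ex. 6.4):
  `ℚ`-isogenous elliptic curves are joined by a `ℚ`-isogeny of degree in Kenku's list, `≤ 163`.
* **(LOC) the local input at a multiplicative prime** — for a `ℚ`-isogeny `φ : A → B` of degree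
  `n` and a prime `p` of multiplicative reduction of `A`: `B` has multiplicative reduction at `p`
  ("hence both") and `c_p(A) ∣ n · c_p(B)` (equivalently `c_p(A)/(n, c_p(A)) ∣ c_p(B)`, the
  displayed line of the printed proof: Néron component groups are functorial, `[n]_{p,*} = n·`,
  and `Φ_p(A) ≅ ℤ/c_p(A)` with `c_p(A) = v_p(Δ_A)` at a multiplicative prime — Pasten §6.4 p. 22;
  Bosch–Lütkebohmert–Raynaud, *Néron Models*, 7.3; equivalently via the Tate curve, Silverman
  *ATAEC* V.3–V.5). The reduction-type half ("hence both") IS proved here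
  (`hasMultiplicativeReductionAt_of_isIsogenous`, from the tree's theorems that `K`-isogenous
  elliptic curves have good reduction at the same places and the same local polynomials). For the
  divisibility half the tree has Néron models only as the scheme-level predicate `IsNeronModel`
  and the hypothesis structure `NeronComponentData` (`NeronModel.lean`), without functoriality in
  isogenies and without Tate's uniformisation, so it is taken here as the HYPOTHESIS `hdvd`; it is
  not vendored as a named fact by this file (D-0026).

Given (MK) and (LOC) the rest of the proof is elementary arithmetic, formalised here:

* `WeierstrassCurve.Isogeny.hasMultiplicativeReductionAt_of_hasMultiplicativeReductionAt` (any
  number field `K`, places of `𝓞 K`) and `hasMultiplicativeReductionAt_of_isIsogenous` (over `ℚ`,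
  places of `ℤ`, the rendering of the fact) — **"one (hence both) of them"**: multiplicative
  reduction passes along a `K`-isogeny of elliptic curves (local trichotomy; good reduction of
  `W'` would make `W` good, *AEC* VII.7.2, tree `Isogeny.hasGoodReductionAt_of_hasGoodReductionAt`;
  additive reduction of `W'` would make `L_v(W', T) = 1 ≠ 1 ∓ T = L_v(W, T)`, against the
  equality of local polynomials of isogenous curves, tree
  `Isogeny.localPolynomialAt_eq_of_isElliptic`;
  the `ℤ`/`𝓞 ℚ` transport is `f_v = 1 ↔` multiplicative, `conductorExponent_eq_one_iff_holds`,
  with `conductorExponent_eq_of_primesEquiv_eq`);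
* `exists_mul_eq_mul_of_dvd_mul` — if `0 < c, c'`, `c ∣ n c'`, `c' ∣ n' c` with `n, n' ≤ B`,
  then `c · k = c' · m` for some `1 ≤ m, k ≤ B` (write `c/c' = a/b` in lowest terms: `a ∣ n`,
  `b ∣ n'`);
* **`PastenShimura2024_lemma_6_8_of_mazurKenku`** — (MK) ∧ (LOC) ⟹ `PastenShimura2024_lemma_6_8`:
  Mazur–Kenku gives `φ : W → W'` and (by the symmetry of isogeny for elliptic curves,
  `IsIsogenous.symm_of_charZero`, *AEC* III.6.1) `ψ : W' → W` of degrees `≤ 163`; `hdvd` for `φ`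
  and for `ψ` gives `c ∣ deg φ · c'`, `c' ∣ deg ψ · c`; `c, c' ≥ 1` at a multiplicative place
  (`ordMinimalDiscriminant_ne_zero_of_hasMultiplicativeReductionAt`, *AEC* VII.5.1(b)); conclude
  by the arithmetic lemma. (Using a second Mazur–Kenku isogeny `ψ` instead of the dual `β = φ^∨`
  avoids the degree of the dual; the printed `deg β = deg α` would serve equally.)

So a discharge `PastenShimura2024_lemma_6_8_holds` is exactly
`PastenShimura2024_lemma_6_8_of_mazurKenku mazurKenku_exists_cyclic_isogeny_holds hdvd`
once (MK) is discharged and the divisibility `hdvd` is a theorem of the tree.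

## References

* [PastenShimura2024] H. Pasten, *Shimura curves and the abc conjecture*, J. Number Theory 254
  (2024) 214–335 = arXiv:1705.09251, §6.4 and Lemma 6.8 (p. 22). READ.
* [Mazur1978] B. Mazur, *Rational isogenies of prime degree*, Invent. Math. 44 (1978), Thm. 1;
  [Kenku1982] M. A. Kenku, J. Number Theory 15 (1982) 199–202; [SilvermanAEC2009] J. H. Silverman,
  *The Arithmetic of Elliptic Curves*, 2nd ed., IX.6 Example 6.4, III.6.1, VII.5.1(b).
-/

noncomputable section

open scoped Classical

open WeierstrassCurve IsDedekindDomain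

namespace Literature.NumberTheory.EllipticCurves.ModularForms

/-! ### The elementary arithmetic of the printed proof -/

/-- **Numerator and denominator.** If `0 < c`, `0 < c'`, `c ∣ n · c'` and `c' ∣ n' · c` with
`1 ≤ n, n' ≤ B`, then `c · k = c' · m` for some `1 ≤ m ≤ B`, `1 ≤ k ≤ B`: writing `c/c' = a/b` in
lowest terms (`c = g a`, `c' = g b`, `(a, b) = 1`), `a ∣ n b` forces `a ∣ n` and `b ∣ n' a` forces
`b ∣ n'` (the step "the numerator of `c_p(A)/c_p(B)` divides `n`, and similarly for the
denominator" of Pasten's proof of Lemma 6.8). [folklore] -/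
theorem exists_mul_eq_mul_of_dvd_mul {c c' n n' B : ℕ} (hc : 0 < c) (hc' : 0 < c')
    (hn₀ : 0 < n) (hn : n ≤ B) (hn₀' : 0 < n') (hn' : n' ≤ B) (h₁ : c ∣ n * c')
    (h₂ : c' ∣ n' * c) :
    ∃ m k : ℕ, 0 < m ∧ m ≤ B ∧ 0 < k ∧ k ≤ B ∧ c * k = c' * m := by
  obtain ⟨g, a, b, hg, hab, rfl, rfl⟩ := Nat.exists_coprime' (Nat.gcd_pos_of_pos_left c' hc)
  have ha : 0 < a := Nat.pos_of_ne_zero (by rintro rfl; simp at hc)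
  have hb : 0 < b := Nat.pos_of_ne_zero (by rintro rfl; simp at hc')
  -- `a ∣ n` and `b ∣ n'`
  have han : a ∣ n := by
    have h : a * g ∣ n * b * g := by rw [mul_assoc]; exact h₁
    exact hab.dvd_of_dvd_mul_right ((Nat.mul_dvd_mul_iff_right hg).mp h)
  have hbn : b ∣ n' := by
    have h : b * g ∣ n' * a * g := by rw [mul_assoc]; exact h₂
    exact hab.symm.dvd_of_dvd_mul_right ((Nat.mul_dvd_mul_iff_right hg).mp h)
  refine ⟨a, b, ha, (Nat.le_of_dvd hn₀ han).trans hn, hb, (Nat.le_of_dvd hn₀' hbn).trans hn', ?_⟩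
  ring

/-! ### "One (hence both) of them": multiplicative reduction along a `K`-isogeny -/

/-- **Multiplicative reduction is an isogeny invariant** (the "one (hence both) of them" of
Pasten's Lemma 6.8; Silverman, *AEC*, Cor. VII.7.2 for good reduction and Ex. 7.2 / §C.16 for the
type of bad reduction: isogenous curves have the same local factors). For a `K`-isogeny
`φ : W → W'` of elliptic curves over a number field `K` and a finite place `v` of `K` at which
`W` has multiplicative reduction, `W'` has multiplicative reduction at `v`. Proof in the tree:
by the local trichotomy for `W'` at `v` — good reduction of `W'` would give good reduction of `W`
(`Isogeny.hasGoodReductionAt_of_hasGoodReductionAt`, *AEC* VII.7.2, proved in the tree), and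
additive reduction of `W'` would give `L_v(W', T) = 1` whereas `L_v(W, T) = 1 ∓ T` and
`K`-isogenous elliptic curves have the same local polynomial at every finite place
(`Isogeny.localPolynomialAt_eq_of_isElliptic`, Faltings 1983 §5 Kor. 2 / Knapp Thm. 11.67,
proved in the tree). Deliberate dot-notation extension of Mathlib's `WeierstrassCurve`
(namespace `WeierstrassCurve.Isogeny` of the tree's `Isogeny.lean`).
[cite: SilvermanAEC2009, Cor. VII.7.2 and §C.16] -/
theorem _root_.WeierstrassCurve.Isogeny.hasMultiplicativeReductionAt_of_hasMultiplicativeReductionAt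
    {K : Type} [Field K] [NumberField K] {W W' : WeierstrassCurve K} [W.IsElliptic]
    [W'.IsElliptic] (φ : Isogeny W W') {v : HeightOneSpectrum (NumberField.RingOfIntegers K)}
    (hv : W.HasMultiplicativeReductionAt v) : W'.HasMultiplicativeReductionAt v := by
  rcases hasGoodReductionAt_or_hasMultiplicativeReductionAt_or_hasAdditiveReductionAt v W' with
    hg | hm | ha
  · exact absurd (φ.hasGoodReductionAt_of_hasGoodReductionAt hg) hv.not_hasGoodReductionAt
  · exact hm
  · exfalso
    have hP := φ.localPolynomialAt_eq_of_isElliptic v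
    rw [localPolynomialAt_of_hasAdditiveReductionAt ha] at hP
    by_cases hs : W.HasSplitMultiplicativeReductionAt v
    · rw [localPolynomialAt_of_hasSplitMultiplicativeReductionAt hs] at hP
      have h1 := congrArg (fun P : Polynomial ℤ => P.coeff 1) hP
      simp at h1
    · rw [localPolynomialAt_of_hasMultiplicativeReductionAt_of_not_hasSplitMultiplicativeReductionAt
        hv hs] at hP
      have h1 := congrArg (fun P : Polynomial ℤ => P.coeff 1) hP
      simp at h1

/-- **"One (hence both) of them" over `ℚ`, at the places of `ℤ`** (the rendering of
`PastenShimura2024_lemma_6_8`): if `W, W'` are `ℚ`-isogenous elliptic curves over `ℚ` and `W` has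
multiplicative reduction at the place `v` of `ℤ`, so has `W'`. Transported from the place `v'` of
`𝓞 ℚ` over the same prime through `f_v = 1 ↔` multiplicative reduction (Silverman *ATAEC*
IV.10.2(b), tree `conductorExponent_eq_one_iff_holds`) and the `ℤ`/`𝓞 ℚ` bridge
`conductorExponent_eq_of_primesEquiv_eq` (both exponents are `f_p` computed in `ℚ_p`).
[cite: SilvermanAEC2009, Cor. VII.7.2 and §C.16] -/
theorem hasMultiplicativeReductionAt_of_isIsogenous {W W' : WeierstrassCurve ℚ} [W.IsElliptic]
    [W'.IsElliptic] (h : W.IsIsogenous W') (v : HeightOneSpectrum ℤ)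
    (hv : W.HasMultiplicativeReductionAt v) : W'.HasMultiplicativeReductionAt v := by
  obtain ⟨φ⟩ := h
  -- the place of `𝓞 ℚ` above the same prime
  set v' : HeightOneSpectrum (NumberField.RingOfIntegers ℚ) :=
    (Rat.HeightOneSpectrum.primesEquiv (R := NumberField.RingOfIntegers ℚ)).symm
      (Rat.HeightOneSpectrum.primesEquiv v) with hv'def
  have hvv' : (Rat.HeightOneSpectrum.primesEquiv v : Nat.Primes) =
      Rat.HeightOneSpectrum.primesEquiv v' := by
    rw [hv'def, Equiv.apply_symm_apply]
  -- `W` is multiplicative at `v'`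
  have h1 : W.conductorExponent v = 1 := (conductorExponent_eq_one_iff_holds v W).mpr hv
  rw [conductorExponent_eq_of_primesEquiv_eq v v' W hvv'] at h1
  have hW : W.HasMultiplicativeReductionAt v' := (conductorExponent_eq_one_iff_holds v' W).mp h1
  -- hence so is `W'`, at `v'` and at `v`
  have hW' : W'.HasMultiplicativeReductionAt v' :=
    φ.hasMultiplicativeReductionAt_of_hasMultiplicativeReductionAt hW
  have h1' : W'.conductorExponent v' = 1 := (conductorExponent_eq_one_iff_holds v' W').mpr hW'
  rw [← conductorExponent_eq_of_primesEquiv_eq v v' W' hvv'] at h1'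
  exact (conductorExponent_eq_one_iff_holds v W').mp h1'

/-! ### Lemma 6.8 from Mazur–Kenku and the local divisibility -/

/-- **Pasten 2024, Lemma 6.8, reduced to its two printed inputs.** Assume
(MK) the tree's named fact `mazurKenku_exists_cyclic_isogeny` (Mazur 1978, Thm. 1; Kenku 1982;
Silverman *AEC* IX.6 Ex. 6.4: a cyclic `ℚ`-isogeny of degree in Kenku's list, `≤ 163`, between
any two `ℚ`-isogenous elliptic curves over `ℚ`), and
(`hdvd`) the local divisibility of the printed proof: for every `ℚ`-isogeny `φ : W → W'` of
elliptic curves and every place `v` of `ℤ` at which both have multiplicative reduction,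
`c_v(W) ∣ deg φ · c_v(W')`, i.e. `c_v(W)/(deg φ, c_v(W)) ∣ c_v(W')` with `c_v = ord_v Δ_min`
(`Φ_v` functorial, `[n]_{v,*} = n·`, `Φ_v(W) ≅ ℤ/c_v(W)` at a multiplicative place; Pasten §6.4
p. 22 — NOT a theorem of the tree, which has neither the functoriality of Néron component groups
nor the Tate curve). Then `PastenShimura2024_lemma_6_8` holds: for `ℚ`-isogenous elliptic
`W, W'` and `v` multiplicative for `W` there are `1 ≤ m, n ≤ 163` with `c_v(W) · n = c_v(W') · m`.
Proof as printed (p. 22): `W'` is multiplicative at `v` too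
(`hasMultiplicativeReductionAt_of_isIsogenous`, proved above); Mazur–Kenku gives `φ : W → W'`
and — isogeny being symmetric for elliptic curves, *AEC* III.6.1, `IsIsogenous.symm_of_charZero`
— `ψ : W' → W`, of degrees `≤ 163` (a second Mazur–Kenku isogeny in place of the dual `φ^∨`,
which avoids the degree of the dual; the printed `deg φ^∨ = deg φ` would serve equally); `hdvd`
gives `c ∣ deg φ · c'` and `c' ∣ deg ψ · c`; `c, c' ≥ 1` at a multiplicative place
(*AEC* VII.5.1(b), `ordMinimalDiscriminant_ne_zero_of_hasMultiplicativeReductionAt`); conclude by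
`exists_mul_eq_mul_of_dvd_mul`. [cite: PastenShimura2024, Lemma 6.8 and its proof (p. 22)] -/
theorem PastenShimura2024_lemma_6_8_of_mazurKenku (hMK : mazurKenku_exists_cyclic_isogeny)
    (hdvd : ∀ (W W' : WeierstrassCurve ℚ) [W.IsElliptic] [W'.IsElliptic] (φ : Isogeny W W')
      (v : HeightOneSpectrum ℤ), W.HasMultiplicativeReductionAt v →
        W'.HasMultiplicativeReductionAt v →
          W.ordMinimalDiscriminant v ∣ φ.degree * W'.ordMinimalDiscriminant v) :
    PastenShimura2024_lemma_6_8 := by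
  intro W W' _ _ hiso v hv
  -- "hence both"
  have hv' : W'.HasMultiplicativeReductionAt v :=
    hasMultiplicativeReductionAt_of_isIsogenous hiso v hv
  -- Mazur–Kenku in both directions (isogeny is symmetric for elliptic curves, AEC III.6.1)
  obtain ⟨φ, -, hφ⟩ := hMK W W' hiso
  obtain ⟨ψ, -, hψ⟩ := hMK W' W (IsIsogenous.symm_of_charZero hiso)
  -- the two divisibilities of the printed proof
  have h₁ := hdvd W W' φ v hv hv'
  have h₂ := hdvd W' W ψ v hv' hv
  -- `c_v ≥ 1` at a multiplicative place (AEC VII.5.1(b))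
  have hc := Nat.pos_of_ne_zero
    (WeierstrassCurve.ordMinimalDiscriminant_ne_zero_of_hasMultiplicativeReductionAt v W hv)
  have hc' := Nat.pos_of_ne_zero
    (WeierstrassCurve.ordMinimalDiscriminant_ne_zero_of_hasMultiplicativeReductionAt v W' hv')
  exact exists_mul_eq_mul_of_dvd_mul hc hc' φ.degree_pos (le_of_mem_kenkuDegrees hφ) ψ.degree_pos
    (le_of_mem_kenkuDegrees hψ) h₁ h₂

end Literature.NumberTheory.EllipticCurves.ModularForms

end
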